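import Literature.NumberTheory.IwasawaTheory.ZpExtensionLayerTotallyRamifiedPrime
import Literature.NumberTheory.NumberFields.ClassNumberDivisibilityInExtensions
import HarnessLib

/-!
# Route `AlignedTransportAtTwo`, crux C2 `MainConjectureOfRankZeroBSDAtTwo` (stmt-BirchSwinnertonDyer-22298):
# `e_n ≤ e_m` ABOVE THE FUKUDA INDEX — the `p`-class numbers of the layers of ANY `ℤ_p`-extension are non-decreasing from `n₀` on
# (a totally ramified prime at every step, Washington Prop. 4.11)

HONEST FRAMING (cell `bsd-f1-sign2`, WIDTH-5 attached prover seat `bsd-line-att-p3` gen 25 on line `birth` of the lead `bsd-line-att-p2`;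
`--supports` stmt-BirchSwinnertonDyer-22298, closes nothing; BSD is NOT proved by any of this; the crux C2, its verdict «blocked-on
`Rank1Residual.GreenbergMuConjectureIrreducible`» and every registered stub are untouched). THEOREMS ONLY — no definition, no named fact,
no `sorry`; pure `ℤ_p`-extension statements (any number field, any prime), the general form of this seat's `…CubicTowerStrict.classNumberPExp_le_succ`
(there: `p = 2`, odd degree, odd indices). A librarian may re-home it under `Literature/NumberTheory/IwasawaTheory` next to `Fukuda1994Thm1Proofs`.

* `classNumberPExp_le_succ_of_totallyRamifiedFrom` — `TotallyRamifiedFrom κ n₀`, `n₀ ≤ n` ⟹ **`e_n(κ) ≤ e_{n+1}(κ)`** (indeed `h(K_n) ∣ h(K_{n+1})`):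
  some prime `Q` of `K_{n+1}` has inertia group `⊇ Gal(K_{n+1}/K_n)` (tree `ZpExtension.exists_isMaximal_forall_mem_inertia`), so over the
  `IntermediateField.restrict` model `B ≅ K_n` of `K_n` inside `K_{n+1}` its inertia group is ALL of `Gal(K_{n+1}/B)`, i.e. `Q` is totally ramified over
  `B` (Mathlib `Ideal.card_inertia_eq_ramificationIdxIn`), and Washington Prop. 4.11 (tree `classNumber_dvd_classNumber_of_ramificationIdx_eq_finrank`)
  gives `h_B ∣ h(K_{n+1})`.
* `classNumberPExp_mono_of_totallyRamifiedFrom` — `n₀ ≤ n ≤ m` ⟹ `e_n ≤ e_m`.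
Used by the cubic road of C2 (Fukuda layer doors at `p = 2`; the Kilford seeds have `n₀ = 0`): together with `…CubicTowerJumps.classNumberPExp_succ_ne`
the `2`-class number at least doubles at every layer.

References: [Washington1997] Prop. 4.11, §13.3 Lemma 13.15; [Fukuda1994] p. 264; [Lang1990] Ch. 3 §4, Lemma to Thm. 4.3; tree
`ZpExtensionLayerTotallyRamifiedPrime`, `ClassNumberDivisibilityInExtensions`.
-/

set_option linter.dupNamespace false
set_option autoImplicit false

noncomputable section

open scoped Classical NumberField nonZeroDivisors

namespace Summit.BirchSwinnertonDyer.BirchSwinnertonDyer.Theorems.AlignedTransportAtTwoZpTowerMonotone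

open NumberField IsDedekindDomain
open Literature.NumberTheory.NumberFields Literature.NumberTheory.GaloisRepresentations Literature.NumberTheory.IwasawaTheory
  Literature.NumberTheory.EllipticCurves

/-! ## §7 General `p`: `e_n ≤ e_m` above the Fukuda index (`n₀ ≤ n ≤ m`), any `ℤ_p`-extension -/

section ZpMonotone

variable {K : Type} [Field K] [NumberField K] {p : ℕ} [Fact p.Prime]

/-- **MONOTONICITY OF `e_n` ABOVE THE FUKUDA INDEX, any `ℤ_p`-extension**: if every prime ramified in `K_∞/K` is totally ramified in `K_∞/K_{n₀}`
(`TotallyRamifiedFrom κ n₀`) and `n₀ ≤ n`, then `e_n(κ) ≤ e_{n+1}(κ)` — indeed `h(K_n) ∣ h(K_{n+1})`: some prime `Q` of `K_{n+1}` has inertia group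
containing `Gal(K_{n+1}/K_n)` (tree `ZpExtension.exists_isMaximal_forall_mem_inertia`), so `Q` is TOTALLY ramified over `K_n`
(`e(Q ∣ Q ∩ K_n) = #I_{K_{n+1}/K_n}(Q) = [K_{n+1} : K_n]`, Mathlib `Ideal.card_inertia_eq_ramificationIdxIn`), and an extension with a totally
ramified prime meets the Hilbert class field of its base trivially (Washington Prop. 4.11, tree `classNumber_dvd_classNumber_of_ramificationIdx_eq_finrank`).
[cite: Washington1997, Prop. 4.11 and §13.3 (Lemma 13.15, standing assumption)] [cite: Fukuda1994, p. 264 (the index `n₀`)]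
[cite: Lang1990, Ch. 3 §4, Lemma to Thm. 4.3] -/
theorem classNumberPExp_le_succ_of_totallyRamifiedFrom (κ : ZpExtension K p) {n₀ n : ℕ} (hκ : TotallyRamifiedFrom κ n₀) (hn : n₀ ≤ n) :
    classNumberPExp κ n ≤ classNumberPExp κ (n + 1) := by
  classical
  haveI : FiniteDimensional K (κ.layer n) := κ.finiteDimensional_layer_holds n
  haveI : FiniteDimensional K (κ.layer (n + 1)) := κ.finiteDimensional_layer_holds (n + 1)
  haveI : IsGalois K (κ.layer (n + 1)) := κ.isGalois_layer_holds (n + 1)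
  haveI : NumberField (κ.layer n) := NumberField.of_module_finite K _
  haveI : NumberField (κ.layer (n + 1)) := NumberField.of_module_finite K _
  -- `K_n` as an intermediate field `B` of `T = K_{n+1}`
  have hle : κ.layer n ≤ κ.layer (n + 1) := κ.layer_mono (Nat.le_succ n)
  obtain ⟨B, hB⟩ : ∃ B : IntermediateField K (κ.layer (n + 1)), B = IntermediateField.restrict hle := ⟨_, rfl⟩
  let eB : (κ.layer n) ≃ₐ[K] B := (IntermediateField.restrict_algEquiv hle).trans (IntermediateField.equivOfEq hB.symm)
  haveI : FiniteDimensional K B := LinearEquiv.finiteDimensional eB.toLinearEquiv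
  haveI : NumberField B := NumberField.of_module_finite K _
  haveI : IsGalois B (κ.layer (n + 1)) := IsGalois.tower_top_of_isGalois K B (κ.layer (n + 1))
  have hclB : classNumber B = classNumber (κ.layer n) :=
    (Fintype.card_congr (ClassGroup.mulEquiv (RingOfIntegers.mapRingEquiv eB.toRingEquiv)).toEquiv).symm
  -- a prime of `K_{n+1}` whose inertia group contains `Gal(K_{n+1}/K_n)`
  obtain ⟨Q, hQmax, hall⟩ := κ.exists_isMaximal_forall_mem_inertia hκ hn (Nat.le_succ n) (Nat.lt_succ_of_le hn)
  haveI := hQmax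
  -- over `B` the inertia group of `Q` is everything
  haveI : Module.Finite (𝓞 B) (𝓞 (κ.layer (n + 1))) := IsIntegralClosure.finite (𝓞 B) B (κ.layer (n + 1)) (𝓞 (κ.layer (n + 1)))
  haveI : IsGaloisGroup ((κ.layer (n + 1)) ≃ₐ[B] (κ.layer (n + 1))) (𝓞 B) (𝓞 (κ.layer (n + 1))) :=
    IsGaloisGroup.of_isFractionRing _ (𝓞 B) (𝓞 (κ.layer (n + 1))) B (κ.layer (n + 1))
  have htop : Q.inertia ((κ.layer (n + 1)) ≃ₐ[B] (κ.layer (n + 1))) = ⊤ := by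
    rw [eq_top_iff]
    intro g _
    have hg := hall (g.restrictScalars K) fun x hx => by
      have hxB : x ∈ B := by rw [hB, IntermediateField.mem_restrict]; exact hx
      have : x = algebraMap B (κ.layer (n + 1)) ⟨x, hxB⟩ := rfl
      rw [AlgEquiv.restrictScalars_apply, this, AlgEquiv.commutes]
    intro y
    have := hg y
    exact this
  haveI hQBprime : (Q.under (𝓞 B)).IsPrime := Ideal.IsPrime.under (𝓞 B) Q
  have hcard := Ideal.card_inertia_eq_ramificationIdxIn (G := (κ.layer (n + 1)) ≃ₐ[B] (κ.layer (n + 1))) (Q.under (𝓞 B)) Q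
  rw [htop, Subgroup.card_top, IsGalois.card_aut_eq_finrank,
    Ideal.ramificationIdxIn_eq_ramificationIdx (Q.under (𝓞 B)) Q ((κ.layer (n + 1)) ≃ₐ[B] (κ.layer (n + 1)))] at hcard
  have hdvd := classNumber_dvd_classNumber_of_ramificationIdx_eq_finrank B (κ.layer (n + 1)) Q hcard.symm
  rw [hclB] at hdvd
  rw [classNumberPExp_eq_padicValNat_classNumber, classNumberPExp_eq_padicValNat_classNumber]
  exact (padicValNat_dvd_iff_le (classNumber_ne_zero _)).mp (pow_padicValNat_dvd.trans hdvd)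

/-- **`e_n ≤ e_m` for `n₀ ≤ n ≤ m`** (iterate `classNumberPExp_le_succ_of_totallyRamifiedFrom`): above the Fukuda index the `p`-class numbers of the
layers of a `ℤ_p`-extension are non-decreasing. [cite: Washington1997, Prop. 4.11 and §13.3] [cite: Fukuda1994, p. 264] -/
theorem classNumberPExp_mono_of_totallyRamifiedFrom (κ : ZpExtension K p) {n₀ n m : ℕ} (hκ : TotallyRamifiedFrom κ n₀) (hn : n₀ ≤ n)
    (hnm : n ≤ m) : classNumberPExp κ n ≤ classNumberPExp κ m := by
  obtain ⟨k, rfl⟩ := Nat.exists_eq_add_of_le hnm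
  induction k with
  | zero => simp
  | succ k ih =>
    exact (ih (Nat.le_add_right n k)).trans
      ((classNumberPExp_le_succ_of_totallyRamifiedFrom κ hκ (hn.trans (Nat.le_add_right n k))).trans_eq (by ring_nf))

end ZpMonotone

end Summit.BirchSwinnertonDyer.BirchSwinnertonDyer.Theorems.AlignedTransportAtTwoZpTowerMonotone

end
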